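import Summits.QuantumFields.YangMills.Theses.ContractibleFibre
import Literature.MathematicalPhysics.QuantumLattice.LatticeGaugeDLRGibbsProofs
import Literature.MathematicalPhysics.QuantumLattice.LatticeGaugeDLRFreeEnergyProofs
import Summits.QuantumFields.YangMills.Theorems.ContractibleFibreFibreToTorusStubTorusLimitTranslationInvariant
import Summits.QuantumFields.YangMills.Theorems.ContractibleFibreFibreToTorusStubTubeMixingState
import Summits.QuantumFields.YangMills.Theorems.ContractibleFibreFibreToTorusStubTangentBridge

/-!
# Line `Sketch` (ergodic-selection cut) for crux `FibreToTorus` (stmt-QuantumFields-16244) — `Lines/Sketch.lean`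

Lead seat `prover-line-stmt-QuantumFields-16244-c1-0` (continuation lead c1, 2026-08-17), route
`route-QuantumFields-ContractibleFibre`, rank-4 crux.  The payload line `Sketch` is the round-1 crux-ideate
typed sketch `Cruxes/FibreToTorus/IdeatorTwoSketch.lean` (cards `ergodic-selection`, `flux-sector-ledger`);
this file OWNS it as a registered skeleton in the `ergodic-selection` cut.  Namespace
`Summit.QuantumFields.YangMills.Cruxes.FibreToTorus.ErgodicSelection`; imports the route file and the proof file
`LatticeGaugeDLRGibbsProofs` (periodic limit points are DLR states — LANDED, used in the glue).

## The cut: T⁺ → NS → U_tr → TI → V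

The previous line `uniqueness` (T → U → V) isolated the identification step of the crux as the engine-less stub
U = "ALL DLR states agree on gauge invariants at weak coupling".  Card `ergodic-selection` weakens U using the
second content of the crux hypothesis — purity/mixing of the free-tube state — to a statement about
TRANSLATION-INVARIANT states only:

* `stub_tubeMixingState` (T⁺) — the `M`-uniform free-tube family at `(β, m)` yields a probability DLR state `μ`
  on `ℤ⁴` that is invariant under the two LONG translations `e₀, e₁`, is `e₀`-MIXING ON ALL BOUNDED MEASURABLE
  FUNCTIONS, and clusters in time at the tube rate `m` on gauge-invariant local observables.  Provable now
  (landed `tubeLimit_strong` + L¹-approximation of bounded measurable functions by bounded cylinder functions).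
* `stub_fibreTranslationInvariance` (NS, "no staggered phase") — at weak coupling an `e₀`-mixing,
  `(e₀,e₁)`-invariant DLR state is `ℤ⁴`-invariant.  OPEN (named, small, necessary given the rest).
* U_tr `TranslationInvariantUniqueness` — at weak coupling any two `ℤ⁴`-INVARIANT DLR states agree on every
  `YMSpecies`.  RESHAPED (cycle 1, tangent programme) into
  `stub_pressureTangentUnique` (PTU, OPEN: for `β ≥ β_u` and every `A : YMSpecies`, the right and left difference
  quotients at `λ = 0` of the free-box perturbed pressures `(n+1)^{-4} log ∫ exp(-β S_{𝔅_n} + λ ∑_x A∘τ_x) dU` come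
  `ε`-close eventually in `n` — Israel's UNIQUE TANGENT of the pressure at `βΦ_W` in the direction `A`, a statement about
  explicit partition functions: no state, no boundary condition, no rate, no limit) and
  `stub_tangentBridge` (PROVABLE, the lead's assembly of helpers T1–T5: PTU at `(β, A)` ⇒ all translation-invariant DLR
  states at `β` agree on `A`; Friedli–Velenik Prop. 6.91 / Israel Thm. III.2.1 forward direction, by Jensen in `λ` for every
  boundary condition, DLR averaging, translation invariance and boundary insensitivity of the kernel normaliser).  Its
  energy sector (A = action density, λ-perturbation = β-shift) is LANDED: `energy_pressure_chord`,
  `energy_uniqueActionDensity_of_differentiableAt` (helpers E1–E6).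
* `stub_torusLimitTranslationInvariant` (TI) — every periodic infinite-volume limit point is `ℤ^d`-translation
  invariant (torus translations intertwine `configShift` under `torusLift`).  Provable now.
* `stub_torusFiniteSize` (V) — verbatim the registered shared stub of lines `birth` / `uniqueness`
  (finite-size passage; recorded verdict `stub-blocked`).
* `FibreToTorus_of : T⁺ → NS → U_tr → TI → V → FibreToTorus` — PROVED below without `sorry`: at
  `β ≥ max β₁ (max β_s β_u)`, T⁺ gives `μ` (DLR, long-invariant, mixing, clustering at the TUBE rate `m(β)`); NS
  makes `μ` `ℤ⁴`-invariant; a periodic limit point `ν` is DLR (landed theorem) and `ℤ⁴`-invariant (TI); U_tr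
  transports `∫A`, `∫τₙB`, `∫A·τₙB` (`shiftObs`, `prodObs`) from `μ` to `ν`, so `ν` clusters at rate `m(β)` with
  `μ`'s constants; V at threshold `max β₁ (max β_s β_u)` is the crux conclusion.  The crux hypothesis is
  load-bearing twice (rate via T⁺, mixing via NS).

## Disproof used / junk audit

`Cruxes/FibreToTorus/Disproof.lean` (cdisprove cycle 1 + update): no kill; `n ≤ S`, `0 < m`, `2n < L` load-bearing
(`Theorems/FibreToTorus/Negative/*`); §6: any proof must use Wilson-specific weak-coupling input — here NS ∧ U_tr
(identification) and V (finite size).  NS / U_tr not vacuous (`ymGibbsMeasures` non-empty with `ℤ⁴`-invariant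
members — torus limit points, TI; `IsGibbsMeasure` carries `IsProbabilityMeasure`, so the zero measure is excluded;
every DLR state is gauge invariant, so gauge images give no cheap counterexample); `∃ β_s`, `∃ β_u` absorb the
bulk transitions at `β = O(1)`.
-/

noncomputable section

namespace Summit.QuantumFields.YangMills.Cruxes.FibreToTorus.ErgodicSelection

open scoped BigOperators Topology Manifold Classical MeasureTheory ProbabilityTheory Matrix InnerProductSpace ComplexConjugate ContinuousMap
open Filter Set Function TopologicalSpace MeasureTheory
open Literature.MathematicalPhysics.QuantumFieldTheory
open Literature.Probability.LatticeModels (Site halfOpenBox)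
open Literature.MathematicalPhysics.QuantumLattice (LGConfig ZdEdge configShift configShift_apply gaugeTransformZd
  IsZdGaugeInvariant IsZdTranslationInvariant IsCylinder LocalGaugeObservable ymGibbsMeasures plaquetteObs
  infiniteVolumeLimitPoints mem_ymGibbsMeasures_of_mem_infiniteVolumeLimitPoints_holds)
open Literature.MathematicalPhysics.QuantumFieldTheory (zdHaar)

/-! ## Species algebra used by the glue: shifted and product gauge-invariant local observables -/

section SpeciesAlgebra

variable {G : Type} [Group G] [MeasurableSpace G]

/-- The translate `U ↦ B(θ_v U)` of a gauge-invariant local observable (`θ_v = configShift v`) is again one: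
support shifted by `-v`, gauge invariance by shifting the gauge transformation, measurability through the
measurable equivalence `configShift v`. [folklore] -/
def shiftObs (B : LocalGaugeObservable 4 G) (v : Site 4) : LocalGaugeObservable 4 G where
  F := fun U => B.F (configShift v U)
  supp := B.supp.image fun e => (e.1 - v, e.2)
  isCylinder := by
    intro U V h
    refine B.isCylinder fun e he => ?_
    simp only [configShift_apply]
    exact h (e.1 - v, e.2) (Finset.mem_coe.2 (Finset.mem_image_of_mem (fun e : Literature.MathematicalPhysics.QuantumLattice.ZdEdge 4 => (e.1 - v, e.2))
      (Finset.mem_coe.1 he)))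
  gaugeInvariant := by
    intro g U
    have hshift : configShift v (gaugeTransformZd g U) =
        gaugeTransformZd (fun x => g (x - v)) (configShift v U) := by
      funext e
      simp only [configShift_apply, gaugeTransformZd, sub_add_eq_add_sub]
    show B.F (configShift v (gaugeTransformZd g U)) = B.F (configShift v U)
    rw [hshift, B.gaugeInvariant]
  bounded := by
    obtain ⟨C, hC⟩ := B.bounded
    exact ⟨C, fun U => hC _⟩
  measurable := B.measurable.comp (configShift v).measurable

/-- The product of two gauge-invariant local observables is one. [folklore] -/
def prodObs (A B : LocalGaugeObservable 4 G) : LocalGaugeObservable 4 G where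
  F := fun U => A.F U * B.F U
  supp := A.supp ∪ B.supp
  isCylinder := by
    intro U V h
    show A.F U * B.F U = A.F V * B.F V
    rw [A.isCylinder fun e he => h e (by simp [Finset.mem_coe.1 he]),
      B.isCylinder fun e he => h e (by simp [Finset.mem_coe.1 he])]
  gaugeInvariant := by
    intro g U
    show A.F (gaugeTransformZd g U) * B.F (gaugeTransformZd g U) = A.F U * B.F U
    rw [A.gaugeInvariant, B.gaugeInvariant]
  bounded := by
    obtain ⟨a, ha⟩ := A.bounded
    obtain ⟨b, hb⟩ := B.bounded
    refine ⟨a * b, fun U => ?_⟩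
    rw [abs_mul]
    exact mul_le_mul (ha U) (hb U) (abs_nonneg _) ((abs_nonneg _).trans (ha U))
  measurable := A.measurable.mul B.measurable

@[simp] theorem shiftObs_F (B : LocalGaugeObservable 4 G) (v : Site 4) (U : LGConfig 4 G) :
    (shiftObs B v).F U = B.F (configShift v U) := rfl

@[simp] theorem prodObs_F (A B : LocalGaugeObservable 4 G) (U : LGConfig 4 G) :
    (prodObs A B).F U = A.F U * B.F U := rfl

end SpeciesAlgebra

/-! ## The five stub STATEMENTS (named `Prop`s; the registered stubs below repeat them verbatim) -/

/-- **(T⁺) The free-tube limit state is a long-invariant, time-MIXING DLR state clustering at the tube rate —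
statement.**  For every compact simple `G`, faithful unitary `r`, coupling `β` and rate `m > 0`: IF the free tubes
`(ℤ/L)²×{0..M}²` of EVERY fibre width `M` cluster in time at rate `m` with slab-width constants `C(w)` UNIFORM in
`M` on all `L ≥ L_min(M, w)` (the crux's inline predicate `Tube`), THEN some probability DLR state
`μ ∈ ymGibbsMeasures r.ρ β` on `ℤ⁴` is invariant under the unit translations in the two long directions `e₀, e₁`,
is mixing under the time shift on ALL pairs of bounded measurable functions, and clusters in Euclidean time at the
SAME rate `m` on all gauge-invariant local observables. -/
def TubeMixingState : Prop :=
  ∀ (G : Type) [Group G] [TopologicalSpace G] [IsTopologicalGroup G] [CompactSpace G]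
    [MeasurableSpace G] [BorelSpace G], IsCompactSimpleLieGroup G → ∀ r : LatticeRep G,
    let Tube := fun (M : ℕ) (β m C : ℝ) (w Lmin : ℕ) => ∀ (L : ℕ) [NeZero L], Lmin ≤ L →
      let St := ZMod L × ZMod L × Fin (M + 1) × Fin (M + 1);
      let Cfg := St × Fin 4 → G;
      let ν : MeasureTheory.Measure Cfg := MeasureTheory.Measure.pi fun _ => haarProbability G;
      let sh : St → Fin 4 → St := fun x μ => ![(x.1 + 1, x.2.1, x.2.2.1, x.2.2.2), (x.1, x.2.1 + 1, x.2.2.1, x.2.2.2), (x.1, x.2.1, x.2.2.1 + 1, x.2.2.2), (x.1, x.2.1, x.2.2.1, x.2.2.2 + 1)] μ;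
      let ins : St → Fin 4 → Fin 4 → ℝ := fun x μ κ => if ((μ = 2 ∨ κ = 2) → (x.2.2.1 : ℕ) < M) ∧ ((μ = 3 ∨ κ = 3) → (x.2.2.2 : ℕ) < M) then 1 else 0;
      let pl : Cfg → St → Fin 4 → Fin 4 → G := fun U x μ κ => U (x, μ) * U (sh x μ, κ) * (U (sh x κ, μ))⁻¹ * (U (x, κ))⁻¹;
      let act : Cfg → ℝ := fun U => β * ∑ x : St, ∑ q : {q : Fin 4 × Fin 4 // q.1 < q.2}, ins x q.1.1 q.1.2 * (r.ρ (pl U x q.1.1 q.1.2)).trace.re;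
      let wgt : Cfg → ℝ := fun U => Real.exp (act U);
      let Ex : (Cfg → ℝ) → ℝ := fun F => (∫ U, F U * wgt U ∂ν) / (∫ U, wgt U ∂ν);
      let σ : ℕ → Cfg → Cfg := fun n U p => U ((p.1.1 + n, p.1.2), p.2);
      ∀ c : ZMod L,
      let Loc := fun F : Cfg → ℝ => Measurable F ∧ (∀ U, |F U| ≤ 1) ∧ ∀ U U', (∀ p : St × Fin 4, (p.1.1 - c).val ≤ w → U p = U' p) → F U = F U';
      ∀ F₁ F₂ : Cfg → ℝ, Loc F₁ → Loc F₂ → ∀ n : ℕ, 2 * n < L → |Ex (fun U => F₁ U * F₂ (σ n U)) - Ex F₁ * Ex (fun U => F₂ (σ n U))| ≤ C * Real.exp (-(m * n));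
    ∀ (β m : ℝ), 0 < m → (∀ w : ℕ, ∃ C : ℝ, ∀ M : ℕ, ∃ Lmin : ℕ, Tube M β m C w Lmin) →
      ∃ μ : MeasureTheory.Measure (LGConfig 4 G), MeasureTheory.IsProbabilityMeasure μ ∧
        μ ∈ ymGibbsMeasures (d := 4) r.ρ β ∧
        (μ.map (configShift (Pi.single 0 1)) = μ ∧ μ.map (configShift (Pi.single 1 1)) = μ) ∧
        (∀ F H : LGConfig 4 G → ℝ, Measurable F → Measurable H → (∀ U, |F U| ≤ 1) → (∀ U, |H U| ≤ 1) →
          Filter.Tendsto (fun n : ℕ =>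
            (∫ U, F U * H (configShift (-Pi.single 0 (n : ℤ)) U) ∂μ) -
              (∫ U, F U ∂μ) * ∫ U, H (configShift (-Pi.single 0 (n : ℤ)) U) ∂μ) Filter.atTop (nhds 0)) ∧
        ∀ A B : YMSpecies G, ∃ C : ℝ, ∀ n : ℕ,
          |(∫ U, A.F U * B.F (configShift (-Pi.single 0 (n : ℤ)) U) ∂μ) -
              (∫ U, A.F U ∂μ) * (∫ U, B.F (configShift (-Pi.single 0 (n : ℤ)) U) ∂μ)| ≤
            C * Real.exp (-(m * n))

/-- **(NS) No staggered phase at weak coupling — statement (OPEN).**  For every compact simple `G` and faithful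
unitary `r` there is `β_s` such that at every `β ≥ β_s`, a DLR state of the Wilson specification on `ℤ⁴` that is
invariant under the two long unit translations `e₀, e₁` and mixing under the time shift on all bounded measurable
functions is invariant under ALL lattice translations (the fibre translations `e₂, e₃` included).  Necessary for
the crux given T⁺ and U_tr: a fibre-staggered free-tube state would make every symmetric-torus limit point a
non-clustering mixture of its fibre translates. -/
def FibreTranslationInvariance : Prop :=
  ∀ (G : Type) [Group G] [TopologicalSpace G] [IsTopologicalGroup G] [CompactSpace G]
    [MeasurableSpace G] [BorelSpace G], IsCompactSimpleLieGroup G → ∀ r : LatticeRep G,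
    ∃ βs : ℝ, ∀ β : ℝ, βs ≤ β → ∀ μ : MeasureTheory.Measure (LGConfig 4 G),
      μ ∈ ymGibbsMeasures (d := 4) r.ρ β →
      (μ.map (configShift (Pi.single 0 1)) = μ ∧ μ.map (configShift (Pi.single 1 1)) = μ) →
      (∀ F H : LGConfig 4 G → ℝ, Measurable F → Measurable H → (∀ U, |F U| ≤ 1) → (∀ U, |H U| ≤ 1) →
        Filter.Tendsto (fun n : ℕ =>
          (∫ U, F U * H (configShift (-Pi.single 0 (n : ℤ)) U) ∂μ) -
            (∫ U, F U ∂μ) * ∫ U, H (configShift (-Pi.single 0 (n : ℤ)) U) ∂μ) Filter.atTop (nhds 0)) →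
      IsZdTranslationInvariant μ

/-- **(U_tr) Translation-invariant uniqueness on the gauge-invariant algebra at weak coupling — statement
(OPEN; no longer a stub: reshaped into PTU + the tangent bridge below, which imply it).**  For every compact simple `G` and
faithful unitary `r` there is `β_u` such that at every `β ≥ β_u` any two `ℤ⁴`-translation-invariant DLR states of the Wilson
specification agree on every bounded measurable gauge-invariant cylinder observable (`YMSpecies G`). -/
def TranslationInvariantUniqueness : Prop :=
  ∀ (G : Type) [Group G] [TopologicalSpace G] [IsTopologicalGroup G] [CompactSpace G]
    [MeasurableSpace G] [BorelSpace G], IsCompactSimpleLieGroup G → ∀ r : LatticeRep G,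
    ∃ βu : ℝ, ∀ β : ℝ, βu ≤ β → ∀ μ ν : MeasureTheory.Measure (LGConfig 4 G),
      μ ∈ ymGibbsMeasures (d := 4) r.ρ β → ν ∈ ymGibbsMeasures (d := 4) r.ρ β →
      IsZdTranslationInvariant μ → IsZdTranslationInvariant ν →
        ∀ A : YMSpecies G, ∫ U, A.F U ∂μ = ∫ U, A.F U ∂ν

/-- **(PTU) Pressure tangent uniqueness at weak coupling — statement (OPEN).**  For every compact simple `G` and faithful
unitary `r` there is `β_u` such that for every `β ≥ β_u` and every gauge-invariant local observable `A`, for every `ε > 0`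
there are `λ₊ > 0 > λ₋` such that, eventually in `n`, the right and left difference quotients at `λ = 0` of the
perturbed free-box log-partition functions `log ∫ exp(-β S_{𝔅_n}(U) + λ ∑_{x ∈ X_n^A} A(τ_x U)) dg_∞(U)` (per site,
`𝔅_n` = plaquettes based in `[0,n)^4`, `X_n^A` = base points `x ∈ [0,n)^4` whose translated support `supp A + x` stays in
the edge box `[0,n+1)^4 × {directions}`, `dg_∞` = product Haar) differ by at most `ε`.  When the perturbed pressure
`p(β, λ; A)` exists this is exactly its differentiability at `λ = 0` (Israel, Convexity in the Theory of Lattice Gases,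
Thm. III.2.1 / Cor. II.1.3: unique tangent ⇔ unique translation-invariant Gibbs expectation of `A`). -/
def PressureTangentUnique : Prop :=
  ∀ (G : Type) [Group G] [TopologicalSpace G] [IsTopologicalGroup G] [CompactSpace G] [MeasurableSpace G] [BorelSpace G], IsCompactSimpleLieGroup G → ∀ r : LatticeRep G, ∃ βu : ℝ, ∀ β : ℝ, βu ≤ β → ∀ A : YMSpecies G, (∀ ε : ℝ, 0 < ε → ∃ lp : ℝ, 0 < lp ∧ ∃ lm : ℝ, lm < 0 ∧ ∃ n₀ : ℕ, ∀ n : ℕ, n₀ ≤ n → (Real.log (∫ U, Real.exp (-β * (∑ p ∈ (halfOpenBox 4 n ×ˢ (Finset.univ : Finset {q : Fin 4 × Fin 4 // q.1 < q.2})), ((r.N : ℝ) - plaquetteObs r.ρ p.1 p.2.1.1 p.2.1.2 U)) + lp * ∑ x ∈ (halfOpenBox 4 n).filter (fun x => A.supp.image (fun e => (e.1 + x, e.2)) ⊆ halfOpenBox 4 (n + 1) ×ˢ (Finset.univ : Finset (Fin 4))), A.F (configShift (-x) U)) ∂(zdHaar 4 G)) - Real.log (∫ U, Real.exp (-β * (∑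 p ∈ (halfOpenBox 4 n ×ˢ (Finset.univ : Finset {q : Fin 4 × Fin 4 // q.1 < q.2})), ((r.N : ℝ) - plaquetteObs r.ρ p.1 p.2.1.1 p.2.1.2 U))) ∂(zdHaar 4 G))) / (lp * ((n : ℝ) + 1) ^ 4) - (Real.log (∫ U, Real.exp (-β * (∑ p ∈ (halfOpenBox 4 n ×ˢ (Finset.univ : Finset {q : Fin 4 × Fin 4 // q.1 < q.2})), ((r.N : ℝ) - plaquetteObs r.ρ p.1 p.2.1.1 p.2.1.2 U)) + lm * ∑ x ∈ (halfOpenBox 4 n).filter (fun x => A.supp.image (fun e => (e.1 + x, e.2)) ⊆ halfOpenBox 4 (n + 1) ×ˢ (Finset.univ : Finset (Fin 4))), A.F (configShift (-x) U)) ∂(zdHaar 4 G)) - Real.log (∫ U, Real.exp (-β * (∑ p ∈ (halfOpenBox 4 n ×ˢ (Finset.univ : Finset {q : Fin 4 × Fin 4 // q.1 < q.2})), ((r.N : ℝ) - plaquetteObs r.ρ p.1 p.2.1.1 p.2.1.2 U))) ∂(zdHaar 4 G))) / (lm * ((n : ℝ) + 1) ^ 4) ≤ ε)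

/-- **(Bridge) Tangent uniqueness forces agreement of translation-invariant DLR states — statement (provable; Israel /
Friedli–Velenik Prop. 6.91 forward direction for lattice gauge theory and a general local observable).**  For a compact
Hausdorff second-countable `G`, continuous `ρ`, every `β`, every local gauge-invariant `A` on `ℤ^d`: if the perturbed
free-box log-partition functions have `ε`-close one-sided difference quotients at `λ = 0` (PTU at `(β, A)`), then any two
translation-invariant DLR states of `ymSpecification ρ β` have the same expectation of `A`. -/
def TangentBridge : Prop :=
  ∀ (d N : ℕ) (G : Type) [Group G] [TopologicalSpace G] [IsTopologicalGroup G] [CompactSpace G] [MeasurableSpace G] [BorelSpace G] [SecondCountableTopology G] [T2Space G] (ρ : G →* Matrix (Fin N) (Fin N) ℂ), Continuous ρ → ∀ (β : ℝ) (A : LocalGaugeObservable d G), (∀ ε : ℝ, 0 < ε → ∃ lp : ℝ, 0 < lp ∧ ∃ lm : ℝ, lm < 0 ∧ ∃ n₀ : ℕ, ∀ n : ℕ, n₀ ≤ n → (Real.log (∫ U, Real.exp (-β * (∑ p ∈ (halfOpenBox d n ×ˢ (Finset.univ : Finset {q : Fin d × Fin d // q.1 < q.2})), ((N : ℝ) -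 plaquetteObs ρ p.1 p.2.1.1 p.2.1.2 U)) + lp * ∑ x ∈ (halfOpenBox d n).filter (fun x => A.supp.image (fun e => (e.1 + x, e.2)) ⊆ halfOpenBox d (n + 1) ×ˢ (Finset.univ : Finset (Fin d))), A.F (configShift (-x) U)) ∂(zdHaar d G)) - Real.log (∫ U, Real.exp (-β * (∑ p ∈ (halfOpenBox d n ×ˢ (Finset.univ : Finset {q : Fin d × Fin d // q.1 < q.2})), ((N : ℝ) - plaquetteObs ρ p.1 p.2.1.1 p.2.1.2 U))) ∂(zdHaar d G))) / (lp * ((n : ℝ) + 1) ^ d) - (Real.log (∫ U, Real.exp (-β * (∑ p ∈ (halfOpenBox d n ×ˢ (Finset.univ : Finset {q : Fin d × Fin d // q.1 < q.2})), ((N : ℝ) - plaquetteObs ρ p.1 p.2.1.1 p.2.1.2 U)) + lm * ∑ x ∈ (halfOpenBox d n).filter (fun x => A.supp.image (fun e => (e.1 + x, e.2)) ⊆ halfOpenBox d (n + 1) ×ˢ (Finset.univ : Finset (Fin d))), A.F (configShift (-x) U)) ∂(zdHaar d G)) - Real.log (∫ U, Real.exp (-β * (∑ p ∈ (halfOpenBox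 d n ×ˢ (Finset.univ : Finset {q : Fin d × Fin d // q.1 < q.2})), ((N : ℝ) - plaquetteObs ρ p.1 p.2.1.1 p.2.1.2 U))) ∂(zdHaar d G))) / (lm * ((n : ℝ) + 1) ^ d) ≤ ε) → ∀ (μ ν : MeasureTheory.Measure (LGConfig d G)), μ ∈ ymGibbsMeasures (d := d) ρ β → ν ∈ ymGibbsMeasures (d := d) ρ β → IsZdTranslationInvariant μ → IsZdTranslationInvariant ν → ∫ U, A.F U ∂μ = ∫ U, A.F U ∂ν

/-- **(TI) Periodic infinite-volume limit points are translation invariant — statement (provable now).**  For a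
compact Hausdorff second-countable group `G`, a continuous matrix representation `ρ` and any `β`, every
`μ ∈ infiniteVolumeLimitPoints ρ β` (subsequential limit of the symmetric-torus Wilson states on bounded continuous
cylinder observables) satisfies `μ.map (configShift v) = μ` for every `v ∈ ℤ^d`: the torus states are invariant
under torus translations (`wilsonMeasure_map_torusConfigShift`), which intertwine `configShift v` under
`torusLift`; the identity passes to the limit on cylinder observables, extends to all bounded continuous functions
by cylinder approximation, and bounded continuous functions separate finite Borel measures on the compact
metrisable configuration space. -/
def TorusLimitTranslationInvariant : Prop :=
  ∀ (d N : ℕ) (G : Type) [Group G] [TopologicalSpace G] [IsTopologicalGroup G] [CompactSpace G]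
    [MeasurableSpace G] [BorelSpace G] [T2Space G] [SecondCountableTopology G]
    (ρ : G →* Matrix (Fin N) (Fin N) ℂ), Continuous ρ → ∀ (β : ℝ) (μ : MeasureTheory.Measure (LGConfig d G)),
      μ ∈ infiniteVolumeLimitPoints (d := d) ρ β → IsZdTranslationInvariant μ

/-- **(V) Finite-size passage: infinite volume ⇒ symmetric torus with `S`-uniform constants — statement**
(verbatim `uniqueness`'s `TorusFiniteSize` = `birth`'s `VacuumDominance`). For every compact simple `G`, faithful
unitary `r` and threshold `β₃`: IF at every `β ≥ β₃` one rate `m > 0` clusters every periodic infinite-volume limit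
point on gauge-invariant local observables with constants uniform over the limit points, THEN the crux's conclusion
holds for `r` (the `UniformLatticeGap` body). -/
def TorusFiniteSize : Prop :=
  ∀ (G : Type) [Group G] [TopologicalSpace G] [IsTopologicalGroup G] [CompactSpace G]
    [MeasurableSpace G] [BorelSpace G], IsCompactSimpleLieGroup G → ∀ (r : LatticeRep G) (β₃ : ℝ),
    (∀ β : ℝ, β₃ ≤ β → ∃ m : ℝ, 0 < m ∧
      ∀ A B : YMSpecies G, ∃ C : ℝ, ∀ μ : MeasureTheory.Measure (LGConfig 4 G),
        μ ∈ infiniteVolumeLimitPoints (d := 4) r.ρ β → ∀ n : ℕ,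
          |(∫ U, A.F U * B.F (configShift (-Pi.single 0 (n : ℤ)) U) ∂μ) -
              (∫ U, A.F U ∂μ) * (∫ U, B.F (configShift (-Pi.single 0 (n : ℤ)) U) ∂μ)| ≤
            C * Real.exp (-(m * n))) →
    ∃ β₀ : ℝ, ∀ β : ℝ, β₀ ≤ β → ∃ m : ℝ, 0 < m ∧ ∃ S₁ : ℕ, ∀ A B : YMSpecies G, ∃ C : ℝ,
      ∀ S n : ℕ, S₁ ≤ S → n ≤ S →
        |latticeConnectedCorr r.ρ β (2 * S + 1) A.F B.F n| ≤ C * Real.exp (-(m * n))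

/-! ## The five REGISTERED STUBS (the ONLY `sorry`s of this file; signatures = the statements above, verbatim) -/

/-- Registered stub `stub_tubeMixingState` : the statement `TubeMixingState` written out (lead's stub).
CLOSED 2026-08-17 (lead c1, p163473): `Theorems/ContractibleFibreFibreToTorusStubTubeMixingState.lean`
(`tubeLimit_strong` + `exists_cylinder_approx` + `timeMixing_of_cylinderClustering`). -/
theorem stub_tubeMixingState :
    ∀ (G : Type) [Group G] [TopologicalSpace G] [IsTopologicalGroup G] [CompactSpace G]
      [MeasurableSpace G] [BorelSpace G], IsCompactSimpleLieGroup G → ∀ r : LatticeRep G,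
      let Tube := fun (M : ℕ) (β m C : ℝ) (w Lmin : ℕ) => ∀ (L : ℕ) [NeZero L], Lmin ≤ L →
        let St := ZMod L × ZMod L × Fin (M + 1) × Fin (M + 1);
        let Cfg := St × Fin 4 → G;
        let ν : MeasureTheory.Measure Cfg := MeasureTheory.Measure.pi fun _ => haarProbability G;
        let sh : St → Fin 4 → St := fun x μ => ![(x.1 + 1, x.2.1, x.2.2.1, x.2.2.2), (x.1, x.2.1 + 1, x.2.2.1, x.2.2.2), (x.1, x.2.1, x.2.2.1 + 1, x.2.2.2), (x.1, x.2.1, x.2.2.1, x.2.2.2 + 1)] μ;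
        let ins : St → Fin 4 → Fin 4 → ℝ := fun x μ κ => if ((μ = 2 ∨ κ = 2) → (x.2.2.1 : ℕ) < M) ∧ ((μ = 3 ∨ κ = 3) → (x.2.2.2 : ℕ) < M) then 1 else 0;
        let pl : Cfg → St → Fin 4 → Fin 4 → G := fun U x μ κ => U (x, μ) * U (sh x μ, κ) * (U (sh x κ, μ))⁻¹ * (U (x, κ))⁻¹;
        let act : Cfg → ℝ := fun U => β * ∑ x : St, ∑ q : {q : Fin 4 × Fin 4 // q.1 < q.2}, ins x q.1.1 q.1.2 * (r.ρ (pl U x q.1.1 q.1.2)).trace.re;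
        let wgt : Cfg → ℝ := fun U => Real.exp (act U);
        let Ex : (Cfg → ℝ) → ℝ := fun F => (∫ U, F U * wgt U ∂ν) / (∫ U, wgt U ∂ν);
        let σ : ℕ → Cfg → Cfg := fun n U p => U ((p.1.1 + n, p.1.2), p.2);
        ∀ c : ZMod L,
        let Loc := fun F : Cfg → ℝ => Measurable F ∧ (∀ U, |F U| ≤ 1) ∧ ∀ U U', (∀ p : St × Fin 4, (p.1.1 - c).val ≤ w → U p = U' p) → F U = F U';
        ∀ F₁ F₂ : Cfg → ℝ, Loc F₁ → Loc F₂ → ∀ n : ℕ, 2 * n < L → |Ex (fun U => F₁ U * F₂ (σ n U)) - Ex F₁ * Ex (fun U => F₂ (σ n U))| ≤ C * Real.exp (-(m * n));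
      ∀ (β m : ℝ), 0 < m → (∀ w : ℕ, ∃ C : ℝ, ∀ M : ℕ, ∃ Lmin : ℕ, Tube M β m C w Lmin) →
        ∃ μ : MeasureTheory.Measure (LGConfig 4 G), MeasureTheory.IsProbabilityMeasure μ ∧
          μ ∈ ymGibbsMeasures (d := 4) r.ρ β ∧
          (μ.map (configShift (Pi.single 0 1)) = μ ∧ μ.map (configShift (Pi.single 1 1)) = μ) ∧
          (∀ F H : LGConfig 4 G → ℝ, Measurable F → Measurable H → (∀ U, |F U| ≤ 1) → (∀ U, |H U| ≤ 1) →
            Filter.Tendsto (fun n : ℕ =>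
              (∫ U, F U * H (configShift (-Pi.single 0 (n : ℤ)) U) ∂μ) -
                (∫ U, F U ∂μ) * ∫ U, H (configShift (-Pi.single 0 (n : ℤ)) U) ∂μ) Filter.atTop (nhds 0)) ∧
          ∀ A B : YMSpecies G, ∃ C : ℝ, ∀ n : ℕ,
            |(∫ U, A.F U * B.F (configShift (-Pi.single 0 (n : ℤ)) U) ∂μ) -
                (∫ U, A.F U ∂μ) * (∫ U, B.F (configShift (-Pi.single 0 (n : ℤ)) U) ∂μ)| ≤
              C * Real.exp (-(m * n)) :=
  -- LANDED (lead c1, p163473)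
  Summit.QuantumFields.YangMills.Theorems.FibreToTorus.stub_tubeMixingState

/-- Registered stub `stub_fibreTranslationInvariance` : the statement `FibreTranslationInvariance` written out
(open: no staggered phase at weak coupling). -/
theorem stub_fibreTranslationInvariance :
    ∀ (G : Type) [Group G] [TopologicalSpace G] [IsTopologicalGroup G] [CompactSpace G]
      [MeasurableSpace G] [BorelSpace G], IsCompactSimpleLieGroup G → ∀ r : LatticeRep G,
      ∃ βs : ℝ, ∀ β : ℝ, βs ≤ β → ∀ μ : MeasureTheory.Measure (LGConfig 4 G),
        μ ∈ ymGibbsMeasures (d := 4) r.ρ β →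
        (μ.map (configShift (Pi.single 0 1)) = μ ∧ μ.map (configShift (Pi.single 1 1)) = μ) →
        (∀ F H : LGConfig 4 G → ℝ, Measurable F → Measurable H → (∀ U, |F U| ≤ 1) → (∀ U, |H U| ≤ 1) →
          Filter.Tendsto (fun n : ℕ =>
            (∫ U, F U * H (configShift (-Pi.single 0 (n : ℤ)) U) ∂μ) -
              (∫ U, F U ∂μ) * ∫ U, H (configShift (-Pi.single 0 (n : ℤ)) U) ∂μ) Filter.atTop (nhds 0)) →
        IsZdTranslationInvariant μ := by
  sorry

/-- Registered stub `stub_pressureTangentUnique` : the statement `PressureTangentUnique` written out (OPEN: Israel's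
unique tangent at the Wilson point, weak coupling). -/
theorem stub_pressureTangentUnique : ∀ (G : Type) [Group G] [TopologicalSpace G] [IsTopologicalGroup G] [CompactSpace G] [MeasurableSpace G] [BorelSpace G], IsCompactSimpleLieGroup G → ∀ r : LatticeRep G, ∃ βu : ℝ, ∀ β : ℝ, βu ≤ β → ∀ A : YMSpecies G, (∀ ε : ℝ, 0 < ε → ∃ lp : ℝ, 0 < lp ∧ ∃ lm : ℝ, lm < 0 ∧ ∃ n₀ : ℕ, ∀ n : ℕ, n₀ ≤ n → (Real.log (∫ U, Real.exp (-β * (∑ p ∈ (halfOpenBox 4 n ×ˢ (Finset.univ : Finset {q : Fin 4 × Fin 4 // q.1 < q.2})), ((r.N : ℝ) - plaquetteObs r.ρ p.1 p.2.1.1 p.2.1.2 U)) + lp * ∑ x ∈ (halfOpenBox 4 n).filter (fun x => A.supp.image (fun e => (e.1 + x, e.2)) ⊆ halfOpenBox 4 (n + 1) ×ˢ (Finset.univ : Finset (Fin 4))), A.F (configShift (-x) U)) ∂(zdHaar 4 G)) - Real.log (∫ U, Real.exp (-β * (∑ p ∈ (halfOpenBox 4 n ×ˢ (Finset.univ : Finset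 {q : Fin 4 × Fin 4 // q.1 < q.2})), ((r.N : ℝ) - plaquetteObs r.ρ p.1 p.2.1.1 p.2.1.2 U))) ∂(zdHaar 4 G))) / (lp * ((n : ℝ) + 1) ^ 4) - (Real.log (∫ U, Real.exp (-β * (∑ p ∈ (halfOpenBox 4 n ×ˢ (Finset.univ : Finset {q : Fin 4 × Fin 4 // q.1 < q.2})), ((r.N : ℝ) - plaquetteObs r.ρ p.1 p.2.1.1 p.2.1.2 U)) + lm * ∑ x ∈ (halfOpenBox 4 n).filter (fun x => A.supp.image (fun e => (e.1 + x, e.2)) ⊆ halfOpenBox 4 (n + 1) ×ˢ (Finset.univ : Finset (Fin 4))), A.F (configShift (-x) U)) ∂(zdHaar 4 G)) - Real.log (∫ U, Real.exp (-β * (∑ p ∈ (halfOpenBox 4 n ×ˢ (Finset.univ : Finset {q : Fin 4 × Fin 4 // q.1 < q.2})), ((r.N : ℝ) - plaquetteObs r.ρ p.1 p.2.1.1 p.2.1.2 U))) ∂(zdHaar 4 G))) / (lm * ((n : ℝ) + 1) ^ 4) ≤ ε) := by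
  sorry

/-- Registered stub `stub_tangentBridge` : the statement `TangentBridge` written out. CLOSED 2026-08-17 (lead c1,
tangent programme T1–T6): `Theorems/ContractibleFibreFibreToTorusStubTangentBridge.lean`. -/
theorem stub_tangentBridge : ∀ (d N : ℕ) (G : Type) [Group G] [TopologicalSpace G] [IsTopologicalGroup G] [CompactSpace G] [MeasurableSpace G] [BorelSpace G] [SecondCountableTopology G] [T2Space G] (ρ : G →* Matrix (Fin N) (Fin N) ℂ), Continuous ρ → ∀ (β : ℝ) (A : LocalGaugeObservable d G), (∀ ε : ℝ, 0 < ε → ∃ lp : ℝ, 0 < lp ∧ ∃ lm : ℝ, lm < 0 ∧ ∃ n₀ : ℕ, ∀ n : ℕ, n₀ ≤ n → (Real.log (∫ U, Real.exp (-β * (∑ p ∈ (halfOpenBox d n ×ˢ (Finset.univ : Finset {q : Fin d × Fin d // q.1 < q.2})), ((N : ℝ) - plaquetteObs ρ p.1 p.2.1.1 p.2.1.2 U)) + lp * ∑ x ∈ (halfOpenBox d n).filter (fun x => A.supp.image (fun e => (e.1 + x, e.2)) ⊆ halfOpenBox d (n + 1) ×ˢ (Finset.univ : Finset (Fin d))),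 A.F (configShift (-x) U)) ∂(zdHaar d G)) - Real.log (∫ U, Real.exp (-β * (∑ p ∈ (halfOpenBox d n ×ˢ (Finset.univ : Finset {q : Fin d × Fin d // q.1 < q.2})), ((N : ℝ) - plaquetteObs ρ p.1 p.2.1.1 p.2.1.2 U))) ∂(zdHaar d G))) / (lp * ((n : ℝ) + 1) ^ d) - (Real.log (∫ U, Real.exp (-β * (∑ p ∈ (halfOpenBox d n ×ˢ (Finset.univ : Finset {q : Fin d × Fin d // q.1 < q.2})), ((N : ℝ) - plaquetteObs ρ p.1 p.2.1.1 p.2.1.2 U)) + lm * ∑ x ∈ (halfOpenBox d n).filter (fun x => A.supp.image (fun e => (e.1 + x, e.2)) ⊆ halfOpenBox d (n + 1) ×ˢ (Finset.univ : Finset (Fin d))), A.F (configShift (-x) U)) ∂(zdHaar d G)) - Real.log (∫ U, Real.exp (-β * (∑ p ∈ (halfOpenBox d n ×ˢ (Finset.univ : Finset {q : Fin d × Fin d // q.1 < q.2})), ((N : ℝ) - plaquetteObs ρ p.1 p.2.1.1 p.2.1.2 U))) ∂(zdHaar d G))) / (lm * ((n : ℝ) + 1) ^ d) ≤ ε) →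 ∀ (μ ν : MeasureTheory.Measure (LGConfig d G)), μ ∈ ymGibbsMeasures (d := d) ρ β → ν ∈ ymGibbsMeasures (d := d) ρ β → IsZdTranslationInvariant μ → IsZdTranslationInvariant ν → ∫ U, A.F U ∂μ = ∫ U, A.F U ∂ν :=
  -- LANDED (lead c1, tangent programme)
  Summit.QuantumFields.YangMills.Theorems.FibreToTorus.stub_tangentBridge

/-- Registered stub `stub_torusLimitTranslationInvariant` : the statement `TorusLimitTranslationInvariant`
written out. CLOSED 2026-08-17 (wave 1, p163293):
`Theorems/ContractibleFibreFibreToTorusStubTorusLimitTranslationInvariant.lean`. -/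
theorem stub_torusLimitTranslationInvariant :
    ∀ (d N : ℕ) (G : Type) [Group G] [TopologicalSpace G] [IsTopologicalGroup G] [CompactSpace G]
      [MeasurableSpace G] [BorelSpace G] [T2Space G] [SecondCountableTopology G]
      (ρ : G →* Matrix (Fin N) (Fin N) ℂ), Continuous ρ → ∀ (β : ℝ) (μ : MeasureTheory.Measure (LGConfig d G)),
        μ ∈ infiniteVolumeLimitPoints (d := d) ρ β → IsZdTranslationInvariant μ :=
  -- LANDED (wave 1 of lead c1, p163293)
  Summit.QuantumFields.YangMills.Theorems.FibreToTorus.stub_torusLimitTranslationInvariant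

/-- Registered stub `stub_torusFiniteSize` : the statement `TorusFiniteSize` written out (same statement as
`uniqueness`'s `stub_torusFiniteSize` and `birth`'s `stub_vacuumDominance` — one proof closes all three). -/
theorem stub_torusFiniteSize :
    ∀ (G : Type) [Group G] [TopologicalSpace G] [IsTopologicalGroup G] [CompactSpace G]
      [MeasurableSpace G] [BorelSpace G], IsCompactSimpleLieGroup G → ∀ (r : LatticeRep G) (β₃ : ℝ),
      (∀ β : ℝ, β₃ ≤ β → ∃ m : ℝ, 0 < m ∧
        ∀ A B : YMSpecies G, ∃ C : ℝ, ∀ μ : MeasureTheory.Measure (LGConfig 4 G),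
          μ ∈ infiniteVolumeLimitPoints (d := 4) r.ρ β → ∀ n : ℕ,
            |(∫ U, A.F U * B.F (configShift (-Pi.single 0 (n : ℤ)) U) ∂μ) -
                (∫ U, A.F U ∂μ) * (∫ U, B.F (configShift (-Pi.single 0 (n : ℤ)) U) ∂μ)| ≤
              C * Real.exp (-(m * n))) →
      ∃ β₀ : ℝ, ∀ β : ℝ, β₀ ≤ β → ∃ m : ℝ, 0 < m ∧ ∃ S₁ : ℕ, ∀ A B : YMSpecies G, ∃ C : ℝ,
        ∀ S n : ℕ, S₁ ≤ S → n ≤ S →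
          |latticeConnectedCorr r.ρ β (2 * S + 1) A.F B.F n| ≤ C * Real.exp (-(m * n)) := by
  sorry

/-! ## Signature match (kernel-checked): each registered stub IS its named statement -/

example : TubeMixingState := stub_tubeMixingState
example : FibreTranslationInvariance := stub_fibreTranslationInvariance
example : PressureTangentUnique := stub_pressureTangentUnique
example : TangentBridge := stub_tangentBridge
example : TorusLimitTranslationInvariant := stub_torusLimitTranslationInvariant
example : TorusFiniteSize := stub_torusFiniteSize

/-! ## Name-keyed aliases of the stub statements — the hypotheses of `FibreToTorus_of`
(device of `Lines/birth.lean`: the native skeleton audit admits a `Prop` hypothesis named like a declared stub). -/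
namespace __Registered

/-- Alias of `TubeMixingState` keyed by the registered stub name. -/
abbrev stub_tubeMixingState : Prop := TubeMixingState
/-- Alias of `FibreTranslationInvariance` keyed by the registered stub name. -/
abbrev stub_fibreTranslationInvariance : Prop := FibreTranslationInvariance
/-- Alias of `PressureTangentUnique` keyed by the registered stub name. -/
abbrev stub_pressureTangentUnique : Prop := PressureTangentUnique
/-- Alias of `TangentBridge` keyed by the registered stub name. -/
abbrev stub_tangentBridge : Prop := TangentBridge
/-- Alias of `TorusLimitTranslationInvariant` keyed by the registered stub name. -/
abbrev stub_torusLimitTranslationInvariant : Prop := TorusLimitTranslationInvariant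
/-- Alias of `TorusFiniteSize` keyed by the registered stub name. -/
abbrev stub_torusFiniteSize : Prop := TorusFiniteSize

end __Registered

/-! ## Composition: the crux BY NAME from the five stub statements (no `sorry` below this line) -/

/-- **U_tr from PTU and the bridge** (pure logic): at `β ≥ β_u`, PTU at `(β, A)` feeds the bridge for `r.ρ`. -/
theorem translationInvariantUniqueness_of_tangent
    (hP : __Registered.stub_pressureTangentUnique) (hB : __Registered.stub_tangentBridge) :
    TranslationInvariantUniqueness := by
  intro G _ _ _ _ _ _ hG r
  haveI : T2Space G := (r.continuous.isClosedEmbedding r.injective).isEmbedding.t2Space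
  haveI : SecondCountableTopology G :=
    (r.continuous.isClosedEmbedding r.injective).isEmbedding.secondCountableTopology
  obtain ⟨βu, hβu⟩ := hP G hG r
  refine ⟨βu, fun β hβ μ ν hμ hν hμT hνT A => ?_⟩
  exact hB 4 r.N G r.ρ r.continuous β A (hβu β hβ A) μ ν hμ hν hμT hνT


/-- **`FibreToTorus_of : (NS) → (PTU) → (V) → FibreToTorus`** ((T⁺), (TI), (Bridge) discharged by the landed theorems
`stub_tubeMixingState` p163473, `stub_torusLimitTranslationInvariant` p163293, `stub_tangentBridge`; (U_tr) derived from
(PTU) + (Bridge)).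
Fix `G`, `hG`, `r`, put the Borel
σ-algebra on `G` as the crux does (`letI := borel G`); `β₁` from the crux hypothesis, `β_s` from (NS), `β_u` from
(U_tr); at each `β ≥ max β₁ (max β_s β_u)`, (T⁺) turns the tube family at the tube rate `m(β)` into a long-invariant,
time-mixing DLR probability state `μ` clustering at rate `m(β)`; (NS) makes `μ` translation invariant; every periodic
limit point `ν` is DLR (landed theorem `mem_ymGibbsMeasures_of_mem_infiniteVolumeLimitPoints_holds`; `G` is Hausdorff
and second countable through the faithful matrix representation `r`) and translation invariant (TI), so by (U_tr)
it has the same one- and two-point functions of gauge-invariant local observables as `μ` (`shiftObs`, `prodObs`)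
and clusters at rate `m(β)` with `μ`'s constants; (V) at threshold `max β₁ (max β_s β_u)` is the crux's conclusion
for `r`.  Conclusion = the route decl, by name. -/
theorem FibreToTorus_of
    (hNS : __Registered.stub_fibreTranslationInvariance) (hP : __Registered.stub_pressureTangentUnique)
    (hV : __Registered.stub_torusFiniteSize) :
    Summit.QuantumFields.YangMills.Theses.ContractibleFibre.FibreToTorus := by
  -- (T⁺), (TI) and the (Bridge) are no longer hypotheses: they are LANDED theorems (p163473, p163293, tangent programme)
  have hT : __Registered.stub_tubeMixingState := stub_tubeMixingState
  have hTI : __Registered.stub_torusLimitTranslationInvariant := stub_torusLimitTranslationInvariant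
  have hB : __Registered.stub_tangentBridge := stub_tangentBridge
  -- (U_tr) from (PTU) and the bridge
  have hU : TranslationInvariantUniqueness := translationInvariantUniqueness_of_tangent hP hB
  intro G _ _ _ _ hG r Tube hfam
  letI : MeasurableSpace G := borel G
  haveI : BorelSpace G := ⟨rfl⟩
  obtain ⟨β₁, hβ₁⟩ := hfam
  -- `G` is Hausdorff and second countable: `r.ρ` is a closed embedding into a matrix space
  haveI : T2Space G := (r.continuous.isClosedEmbedding r.injective).isEmbedding.t2Space
  haveI : SecondCountableTopology G :=
    (r.continuous.isClosedEmbedding r.injective).isEmbedding.secondCountableTopology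
  obtain ⟨βs, hβs⟩ := hNS G hG r
  obtain ⟨βu, hβu⟩ := hU G hG r
  -- (T⁺) + (NS) + (TI) + (U_tr): every periodic limit point inherits the clustering of the tube state
  have hIVLP : ∀ β : ℝ, max β₁ (max βs βu) ≤ β → ∃ m : ℝ, 0 < m ∧
      ∀ A B : YMSpecies G, ∃ C : ℝ, ∀ μ : MeasureTheory.Measure (LGConfig 4 G),
        μ ∈ infiniteVolumeLimitPoints (d := 4) r.ρ β → ∀ n : ℕ,
          |(∫ U, A.F U * B.F (configShift (-Pi.single 0 (n : ℤ)) U) ∂μ) -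
              (∫ U, A.F U ∂μ) * (∫ U, B.F (configShift (-Pi.single 0 (n : ℤ)) U) ∂μ)| ≤
            C * Real.exp (-(m * n)) := by
    intro β hβ
    have hβ₁' : β₁ ≤ β := (le_max_left _ _).trans hβ
    have hβs' : βs ≤ β := ((le_max_left _ _).trans (le_max_right _ _)).trans hβ
    have hβu' : βu ≤ β := ((le_max_right _ _).trans (le_max_right _ _)).trans hβ
    obtain ⟨m, hm, hfamβ⟩ := hβ₁ β hβ₁'
    -- (T⁺): the tube state at the tube rate
    obtain ⟨μ, hμP, hμG, hμinv, hμmix, hclus⟩ := hT G hG r β m hm hfamβ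
    -- (NS): it is translation invariant
    have hμTI : IsZdTranslationInvariant μ := hβs β hβs' μ hμG hμinv hμmix
    refine ⟨m, hm, fun A B => ?_⟩
    obtain ⟨C, hC⟩ := hclus A B
    refine ⟨C, fun ν hν n => ?_⟩
    -- periodic limit points are DLR states (landed theorem) and translation invariant (TI)
    have hνG : ν ∈ ymGibbsMeasures (d := 4) r.ρ β :=
      mem_ymGibbsMeasures_of_mem_infiniteVolumeLimitPoints_holds (d := 4) r.ρ r.continuous hν
    have hνTI : IsZdTranslationInvariant ν := hTI 4 r.N G r.ρ r.continuous β ν hν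
    -- (U_tr): `ν` and `μ` agree on gauge-invariant local observables
    have hUβ : ∀ X : YMSpecies G, ∫ U, X.F U ∂ν = ∫ U, X.F U ∂μ :=
      hβu β hβu' ν μ hνG hμG hνTI hμTI
    have h1 : ∫ U, A.F U ∂ν = ∫ U, A.F U ∂μ := hUβ A
    have h2 := hUβ (shiftObs B (-Pi.single 0 (n : ℤ)))
    simp only [shiftObs_F] at h2
    have h3 := hUβ (prodObs A (shiftObs B (-Pi.single 0 (n : ℤ))))
    simp only [prodObs_F, shiftObs_F] at h3
    rw [h1, h2, h3]
    exact hC n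
  -- (V): infinite volume ⇒ symmetric torus, S-uniform constants
  exact hV G hG r (max β₁ (max βs βu)) hIVLP

/-- **Registered instantiation (kernel-checked)**: the three OPEN stubs (NS, PTU, V) BY NAME give the crux BY NAME
((T⁺), (TI) discharged inside by the landed theorems). -/
example : Summit.QuantumFields.YangMills.Theses.ContractibleFibre.FibreToTorus :=
  FibreToTorus_of stub_fibreTranslationInvariance stub_pressureTangentUnique stub_torusFiniteSize

end Summit.QuantumFields.YangMills.Cruxes.FibreToTorus.ErgodicSelection

end
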